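import Mathlib
import Literature.MathematicalPhysics.QuantumFieldTheory.MirrorBisectorHalfPlane
import Literature.Analysis.Complex.BoundedCrossTheoremTwoStrips
import HarnessLib

/-!
# The in-plane light cone of a mirror: cone support of the joint spectral measures

Topic `Literature/MathematicalPhysics/QuantumFieldTheory`.  Let `n ⊥ n'` be vectors of equal length
in `ℝ^d`, `n ≠ 0`, and let the correlation family `S` carry kernel-level Osterwalder–Schrader data
in the frames of BOTH bisectors `n + n'`, `n - n'` (`MirrorOSData`, e.g. the lattice mirrors of a
`B₂` pair).  Then for every finitely supported functional `e` on the half-space clusters of `n`,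
every finite measure `μ` on `ℝ²` carried by `{E ≥ 0}` that represents the diagonal two-cluster
function, `⟪ψ_e, e^{-tH} e^{isP} ψ_e⟫ = ∫ e^{-tE + isP} dμ` (`t ≥ 0`), is carried by the LIGHT CONE
`{|P| ≤ E}` (`measure_cone_compl_eq_zero_of_bisectorOSData`).  This is Glimm–Jaffe's Cor. 19.5.4
("the joint spectrum of `(H, P)` lies in the forward cone") obtained NOT from rotation invariance but
from reflection positivity in the two bisecting mirrors:

1. in the light-cone coordinates `u = t + s`, `v = t - s` the function `R_e(t, s)` is, for each
   real `v`, holomorphic and uniformly bounded in `u` on a half-plane `Re u > u₀`, and symmetrically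
   (`exists_halfPlane_extension_rawPairing`, frames `n ± n'`);
2. `u - u₀ = e^ξ`, `v - v₀ = e^η` and the bounded cross theorem for two strips (the named fact
   `Literature.Analysis.Complex.DiamondCross`, hypothesis; proved in
   `Literature/Analysis/Complex/BoundedCrossTheoremTwoStrips.lean`) give one bounded holomorphic function on
   `{|Im ξ| + |Im η| < π/2}`;
3. by Thales (`abs_arg_add_abs_arg_lt`) its slice at real `t` contains the disc `|s| < t - max(u₀,v₀)`,
   on which it is `s ↦ ∫ e^{-tE + isP} dμ`;
4. Lukacs' theorem and support pinning (`LaplaceFourierCone.lean`) conclude.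

NOT here: the holomorphic family on the tube and its contraction bound (the consumer,
`MirrorInPlaneLightCone.lean`).

## References
* J. Glimm, A. Jaffe, *Quantum Physics* (2nd ed. 1987), §19.5, Cor. 19.5.4. [folklore]
* M. Jarnicki, P. Pflug, *Separately Analytic Functions* (EMS 2011) (cross theorem). [folklore]
* E. Lukacs, *Characteristic Functions* (2nd ed. 1970), Thm. 7.1.1. [folklore]
-/

noncomputable section

open scoped InnerProductSpace BigOperators ComplexConjugate
open Literature.Probability.LatticeModels Literature.Analysis.Complex Finset MeasureTheory Complex Set Metric
open Literature.Analysis.Complex (DiamondCross)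

namespace Literature.MathematicalPhysics.QuantumFieldTheory

/-! ### Thales: the disc slice of the diamond of arguments -/

/-- **Thales.**  If `Re w₁, Re w₂ > 0`, `Im w₁ = -Im w₂` and `(Im w₁)² < Re w₁ · Re w₂` (i.e. `w₁ = z - s₁`,
`w₂ = s₂ - z` for `z` inside the disc with diameter `[s₁, s₂]`), then `|arg w₁| + |arg w₂| < π/2`
(the angle at `z` is obtuse; `arg w = arctan (Im w / Re w)` on the right half-plane and the addition
formula of `arctan`). [folklore] -/
theorem abs_arg_add_abs_arg_lt {w₁ w₂ : ℂ} (h1 : 0 < w₁.re) (h2 : 0 < w₂.re) (him : w₁.im = -w₂.im)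
    (hprod : w₁.im ^ 2 < w₁.re * w₂.re) : |arg w₁| + |arg w₂| < Real.pi / 2 := by
  -- `arg = arctan (Im / Re)` on the right half-plane
  have harg : ∀ {w : ℂ}, 0 < w.re → arg w = Real.arctan (w.im / w.re) := fun {w} hw => by
    have h := Complex.abs_arg_lt_pi_div_two_iff.2 (Or.inl hw)
    rw [← Complex.tan_arg, Real.arctan_tan (abs_lt.1 h).1 (abs_lt.1 h).2]
  -- `|arctan y| = arctan |y|`
  have habs : ∀ y : ℝ, |Real.arctan y| = Real.arctan |y| := fun y => by
    rcases le_or_gt 0 y with hy | hy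
    · rw [abs_of_nonneg hy, abs_of_nonneg (Real.arctan_nonneg.2 hy)]
    · rw [abs_of_neg hy, abs_of_neg (Real.arctan_lt_zero.2 hy), Real.arctan_neg]
  rw [harg h1, harg h2, habs, habs, abs_div, abs_div, abs_of_pos h1, abs_of_pos h2]
  have hb : |w₂.im| = |w₁.im| := by rw [him, abs_neg]
  rw [hb]
  set p : ℝ := |w₁.im| / w₁.re
  set q : ℝ := |w₁.im| / w₂.re
  have hpq : p * q < 1 := by
    simp only [p, q]
    rw [div_mul_div_comm, div_lt_one (mul_pos h1 h2), ← sq, sq_abs]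
    exact hprod
  rw [Real.arctan_add hpq]
  exact Real.arctan_lt_pi_div_two _

/-- The elementary inequality behind the disc: for `p, q ≥ R` and `|z| < R`,
`(Im z)² < (Re z + p)(q - Re z)`. [folklore] -/
theorem im_sq_lt_of_norm_lt {z : ℂ} {R p q : ℝ} (hz : ‖z‖ < R) (hp : R ≤ p) (hq : R ≤ q) :
    z.im ^ 2 < (z.re + p) * (q - z.re) := by
  have hR : 0 < R := (norm_nonneg z).trans_lt hz
  have hre : |z.re| < R := (Complex.abs_re_le_norm z).trans_lt hz
  have hsq : z.re ^ 2 + z.im ^ 2 < R ^ 2 := by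
    have : ‖z‖ ^ 2 = z.re ^ 2 + z.im ^ 2 := by rw [Complex.sq_norm, Complex.normSq_apply]; ring
    rw [← this]
    exact pow_lt_pow_left₀ hz (norm_nonneg z) two_ne_zero
  have h1 : (z.re + R) * (R - z.re) ≤ (z.re + p) * (q - z.re) := by
    have ha1 : 0 < z.re + R := by linarith [(abs_lt.1 hre).1]
    have ha2 : 0 < R - z.re := by linarith [(abs_lt.1 hre).2]
    nlinarith
  nlinarith

/-! ### Cone support -/

variable {d : ℕ} {S : CorrFamily d} {n n' : EuclideanSpace ℝ (Fin d)}

/-- The second-variable half-plane: step (1) for the frame `n - n'`, read back in the coordinates of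
`(n, n')` (`n' ↦ -n'` is `s ↦ -s`). [folklore] -/
theorem exists_halfPlane_extension_rawPairing_snd (hb : MirrorOSData S (n - n')) (hn : n ≠ 0)
    (hn' : ⟪n', n⟫_ℝ = 0) (hlen : ‖n‖ = ‖n'‖) (e : HalfSpaceCluster d n →₀ ℂ) :
    ∃ v₀ M : ℝ, 0 ≤ v₀ ∧ ∀ u : ℝ, ∃ g : ℂ → ℂ, DifferentiableOn ℂ g {v : ℂ | v₀ < v.re} ∧
      (∀ v : ℂ, v₀ < v.re → ‖g v‖ ≤ M) ∧
      ∀ v : ℝ, v₀ < v → g v = rawPairing S n n' e ((u + v) / 2) ((u - v) / 2) := by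
  have hb' : MirrorOSData S (n + -n') := by rw [← sub_eq_add_neg]; exact hb
  obtain ⟨v₀, M, hv₀, H⟩ := exists_halfPlane_extension_rawPairing hb' hn (by rw [inner_neg_left, hn', neg_zero])
    (by rw [norm_neg, hlen]) e
  refine ⟨v₀, M, hv₀, fun u => ?_⟩
  obtain ⟨g, hg, hgM, hgeq⟩ := H u
  refine ⟨g, hg, hgM, fun v hv => ?_⟩
  rw [hgeq v hv, rawPairing_neg_right]
  congr 1 <;> ring

/-- **Step (2): the bounded cross theorem in exponential coordinates.**  With the thresholds
`u₀, v₀` of the two bisector frames, `(ξ, η) ↦ R_e` at `u = u₀ + e^ξ`, `v = v₀ + e^η` extends to a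
function holomorphic on the diamond tube `{|Im ξ| + |Im η| < π/2}` and bounded there. [folklore] -/
theorem exists_diamond_extension (hD : DiamondCross) (hb₁ : MirrorOSData S (n + n'))
    (hb₂ : MirrorOSData S (n - n')) (hn : n ≠ 0) (hn' : ⟪n', n⟫_ℝ = 0) (hlen : ‖n‖ = ‖n'‖)
    (e : HalfSpaceCluster d n →₀ ℂ) :
    ∃ u₀ v₀ M : ℝ, 0 ≤ u₀ ∧ 0 ≤ v₀ ∧ ∃ G : ℂ × ℂ → ℂ,
      DifferentiableOn ℂ G {p : ℂ × ℂ | |p.1.im| + |p.2.im| < Real.pi / 2} ∧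
      (∀ p : ℂ × ℂ, |p.1.im| + |p.2.im| < Real.pi / 2 → ‖G p‖ ≤ M) ∧
      ∀ ξ η : ℝ, G ((ξ : ℂ), (η : ℂ)) =
        rawPairing S n n' e ((u₀ + Real.exp ξ + (v₀ + Real.exp η)) / 2) ((u₀ + Real.exp ξ - (v₀ + Real.exp η)) / 2) := by
  obtain ⟨u₀, M₁, hu₀, H₁⟩ := exists_halfPlane_extension_rawPairing hb₁ hn hn' hlen e
  obtain ⟨v₀, M₂, hv₀, H₂⟩ := exists_halfPlane_extension_rawPairing_snd hb₂ hn hn' hlen e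
  -- the exponential chart of a strip of half-width `π/2` onto a right half-plane
  have hchart : ∀ (c : ℝ) (z : ℂ), |z.im| < Real.pi / 2 → c < ((c : ℂ) + exp z).re := by
    intro c z hz
    rw [add_re, ofReal_re, Complex.exp_re]
    have hmem : z.im ∈ Ioo (-(Real.pi / 2)) (Real.pi / 2) := ⟨(abs_lt.1 hz).1, (abs_lt.1 hz).2⟩
    have := mul_pos (Real.exp_pos z.re) (Real.cos_pos_of_mem_Ioo hmem)
    linarith
  have hchartR : ∀ (c ξ : ℝ), (c : ℂ) + exp (ξ : ℂ) = ((c + Real.exp ξ : ℝ) : ℂ) := by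
    intro c ξ; rw [Complex.ofReal_add, Complex.ofReal_exp]
  refine ⟨u₀, v₀, max M₁ M₂, hu₀, hv₀, ?_⟩
  refine hD (Real.pi / 2) (max M₁ M₂) (fun ξ η => rawPairing S n n' e
    ((u₀ + Real.exp ξ + (v₀ + Real.exp η)) / 2) ((u₀ + Real.exp ξ - (v₀ + Real.exp η)) / 2))
    (by positivity) (fun η => ?_) (fun ξ => ?_)
  · obtain ⟨g, hg, hgM, hgeq⟩ := H₁ (v₀ + Real.exp η)
    refine ⟨fun z => g (u₀ + exp z), ?_, fun z hz => (hgM _ (hchart u₀ z hz)).trans (le_max_left _ _),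
      fun ξ => ?_⟩
    · exact hg.comp (by fun_prop) fun z hz => hchart u₀ z hz
    · simp only
      rw [hchartR, hgeq _ (by have := Real.exp_pos ξ; linarith)]
  · obtain ⟨g, hg, hgM, hgeq⟩ := H₂ (u₀ + Real.exp ξ)
    refine ⟨fun z => g (v₀ + exp z), ?_, fun z hz => (hgM _ (hchart v₀ z hz)).trans (le_max_right _ _),
      fun η => ?_⟩
    · exact hg.comp (by fun_prop) fun z hz => hchart v₀ z hz
    · simp only
      rw [hchartR, hgeq _ (by have := Real.exp_pos η; linarith)]

/-- **Step (3): the disc slice.**  From the diamond extension, for every real `t` (interesting when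
`R = t - max u₀ v₀ > 0`): `s ↦ R_e(t, s)` is on `(-R, R)` the restriction of a function holomorphic
and bounded by `M` on the disc `|s| < R` (Thales). [folklore] -/
theorem exists_disc_extension {u₀ v₀ M : ℝ} {G : ℂ × ℂ → ℂ}
    (hG : DifferentiableOn ℂ G {p : ℂ × ℂ | |p.1.im| + |p.2.im| < Real.pi / 2})
    (hGM : ∀ p : ℂ × ℂ, |p.1.im| + |p.2.im| < Real.pi / 2 → ‖G p‖ ≤ M)
    (e : HalfSpaceCluster d n →₀ ℂ)
    (hGeq : ∀ ξ η : ℝ, G ((ξ : ℂ), (η : ℂ)) =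
      rawPairing S n n' e ((u₀ + Real.exp ξ + (v₀ + Real.exp η)) / 2) ((u₀ + Real.exp ξ - (v₀ + Real.exp η)) / 2))
    (t : ℝ) :
    ∃ h : ℂ → ℂ, DifferentiableOn ℂ h (ball 0 (t - max u₀ v₀)) ∧
      (∀ z ∈ ball (0 : ℂ) (t - max u₀ v₀), ‖h z‖ ≤ M) ∧
      ∀ s : ℝ, |s| < t - max u₀ v₀ → h s = rawPairing S n n' e t s := by
  set R : ℝ := t - max u₀ v₀ with hR
  have hRp : R ≤ t - u₀ := by rw [hR]; linarith [le_max_left u₀ v₀]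
  have hRq : R ≤ t - v₀ := by rw [hR]; linarith [le_max_right u₀ v₀]
  -- the chart of the disc into the diamond
  set Ψ : ℂ → ℂ × ℂ := fun z => (log (z + (t - u₀ : ℝ)), log (((t - v₀ : ℝ) : ℂ) - z)) with hΨ
  have hw : ∀ z ∈ ball (0 : ℂ) R, 0 < (z + (t - u₀ : ℝ)).re ∧ 0 < (((t - v₀ : ℝ) : ℂ) - z).re ∧
      |(log (z + (t - u₀ : ℝ))).im| + |(log (((t - v₀ : ℝ) : ℂ) - z)).im| < Real.pi / 2 := by
    intro z hz
    rw [mem_ball, dist_zero_right] at hz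
    have hre : |z.re| < R := (Complex.abs_re_le_norm z).trans_lt hz
    have h1 : 0 < (z + (t - u₀ : ℝ)).re := by
      rw [add_re, ofReal_re]; linarith [(abs_lt.1 hre).1]
    have h2 : 0 < (((t - v₀ : ℝ) : ℂ) - z).re := by
      rw [sub_re, ofReal_re]; linarith [(abs_lt.1 hre).2]
    refine ⟨h1, h2, ?_⟩
    rw [Complex.log_im, Complex.log_im]
    refine abs_arg_add_abs_arg_lt h1 h2 (by simp) ?_
    rw [add_re, ofReal_re, sub_re, ofReal_re, add_im, ofReal_im, add_zero]
    exact im_sq_lt_of_norm_lt hz hRp hRq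
  have hΨmaps : MapsTo Ψ (ball 0 R) {p : ℂ × ℂ | |p.1.im| + |p.2.im| < Real.pi / 2} := fun z hz => (hw z hz).2.2
  have hΨdiff : DifferentiableOn ℂ Ψ (ball 0 R) := by
    intro z hz
    obtain ⟨h1, h2, -⟩ := hw z hz
    refine DifferentiableAt.differentiableWithinAt (DifferentiableAt.prodMk ?_ ?_)
    · exact (Complex.differentiableAt_log (Or.inl h1)).comp z (differentiableAt_id.add_const _)
    · exact (Complex.differentiableAt_log (Or.inl h2)).comp z ((differentiableAt_const _).sub differentiableAt_id)
  refine ⟨G ∘ Ψ, hG.comp hΨdiff hΨmaps, fun z hz => hGM _ (hΨmaps hz), fun s hs => ?_⟩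
  -- real points
  have hs' := abs_lt.1 hs
  have hp : 0 < s + (t - u₀) := by linarith
  have hq : 0 < t - v₀ - s := by linarith
  have e1 : log ((s : ℂ) + (t - u₀ : ℝ)) = ((Real.log (s + (t - u₀)) : ℝ) : ℂ) := by
    rw [Complex.ofReal_log hp.le]; push_cast; ring_nf
  have e2 : log (((t - v₀ : ℝ) : ℂ) - s) = ((Real.log (t - v₀ - s) : ℝ) : ℂ) := by
    rw [Complex.ofReal_log hq.le]; push_cast; ring_nf
  simp only [Function.comp_apply, hΨ, e1, e2]
  rw [hGeq, Real.exp_log hp, Real.exp_log hq]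
  congr 1 <;> ring

/-- **The in-plane light cone of a mirror with two reflection-positive bisectors** (Glimm–Jaffe
Cor. 19.5.4 from bisector reflection positivity instead of rotations).  Let `n ⊥ n'` have equal
lengths, `n ≠ 0`, and let `S` carry OS data in the frames `n + n'` and `n - n'`; assume the bounded
cross theorem `DiamondCross`.  If a finite measure `μ` on `ℝ²` with `μ {E < 0} = 0` represents the
diagonal two-cluster function of a functional `e` of the frame `n`,
`clusterPairing S n' hn' e e t s = ∫ e^{-tE + isP} dμ` for `t ≥ 0`, then `μ {E < |P|} = 0`. [folklore] -/
theorem measure_cone_compl_eq_zero_of_bisectorOSData (hD : DiamondCross) (hb₁ : MirrorOSData S (n + n'))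
    (hb₂ : MirrorOSData S (n - n')) (hn : n ≠ 0) (hn' : ⟪n', n⟫_ℝ = 0) (hlen : ‖n‖ = ‖n'‖)
    (e : HalfSpaceCluster d n →₀ ℂ) (μ : Measure (EuclideanSpace ℝ (Fin 2))) [IsFiniteMeasure μ]
    (hμ0 : μ {p | p 0 < 0} = 0)
    (hrep : ∀ t : ℝ, 0 ≤ t → ∀ s : ℝ,
      clusterPairing S n' hn' e e t s = ∫ p, cexp (-((t : ℂ) * p 0) + I * (s : ℂ) * p 1) ∂μ) :
    μ {p | p 0 < |p 1|} = 0 := by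
  obtain ⟨u₀, v₀, M, hu₀, hv₀, G, hG, hGM, hGeq⟩ := exists_diamond_extension hD hb₁ hb₂ hn hn' hlen e
  refine measure_cone_compl_eq_zero_of_integral_exp_le (C := max u₀ v₀) (M := M) (t₀ := max u₀ v₀ + 1)
    fun t ht β hβ => ?_
  have ht0 : 0 ≤ t := by linarith [le_max_left u₀ v₀]
  obtain ⟨h, hh, hhM, hheq⟩ := exists_disc_extension hG hGM e hGeq t
  refine integral_exp_le_of_laplaceFourier_eq_on_ball hμ0 ht0 (by linarith) hh hhM (fun s hs => ?_) hβ
  rw [hheq s hs, rawPairing_eq_clusterPairing S n' hn' e ht0, hrep t ht0 s]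

end Literature.MathematicalPhysics.QuantumFieldTheory
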